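import Summits.QuantumFields.YangMills.Theorems.BalabanUVNodesN15KingModelFullPropagatorPowerLaw

/-!
# BalabanUVNodes ∕ N15 — THE KING-MODEL RUNG, CURVED EDITION (PART R-d): POWER LAW × BLOCK DECAY FOR THE FULL `A = 0` FLUCTUATION
# PROPAGATOR, ALL PAIRS — `|G^η_K(x, y)| ≤ C·(L^K∕r)^{d−1}·e^{−δ|B(x) − B(y)|}` (`x ≠ y`), which REMOVES the threshold `D₀` of part O-a
# (Track A, DAG node N15 = NE2; FAN-OUT v1.1 §N15 s3 «KING-MODEL RUNG … + the one-line statement of what the curved case adds»)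

HONEST FRAMING.  Count-neutral kernel bookkeeping (cell `pub-ymgap`, seat `pub-ymgap-dag-n15-e` g8; `--supports stmt-QuantumFields-20296
--as helper` = K3⁵ `SpineGivenEndpointR13SepCoP`, WORDS-141).  TEMPLATE LITERATURE, `A = 0`: C. King's scalar U(1)-Higgs MODEL on finite tori ([King1986]
§2.2 p. 653 (2.13)–(2.17), p. 654 (2.20), Theorem 3.3 pp. 655–656 ((3.7) p. 656), Prop. 3.7 (3.63) p. 663), NOT Bałaban's covariant objects; the
statements below are (2.17)-SUMMED SHAPES of (3.63) for King's (2.13) at `A = 0` (Theorem 3.3 ∕ [Ba 4]-type kernel bound «`C|x − y|^{2−d}e^{−δ|x−y|}`»),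
NOT printed propositions; NE2⁺ is NOT PRINTED and not proved here; NOT a node discharge; nothing continuum ∕ ℝ⁴ ∕ OS ∕ mass-gap ∕ Clay.
0 `sorry`, 0 `def`, standard axioms.

THE POINT.  For King's full `A = 0` fluctuation propagator `G(K, M, m²) = constrainedProp (L^K) M (aK a L K) ((L^K)²) m²` the rung now has TWO
all-`K` kernel bounds: part O-a `fullProp_decay_unif` (`|G| ≤ C·e^{−δ|B(x)−B(y)|_M}` for unit blocks `≥ D₀` apart, `D₀ = 1 + 2Λ∕(δ(L−1))`) and parts
R-a∕R-b (`|G| ≤ C·Σ_{i<K}Λ^i e^{−δrL^i∕L^K} ≤ C′·(L^K∕r)^{d−1}`, all pairs, no block decay displayed).  THIS FILE multiplies them: the level sum of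
part R-a ALREADY carries the unit-scale decay (every level decays at least on the unit scale), so splitting its rate in two gives
* §1 `exp_level_split` ∕ **`levelSum_decay_split`** — `Σ_{i<K}Λ^i e^{−δrL^i∕N} ≤ e^{δ∕2}·e^{−(δ∕2)·|B(x)−B(y)|}·Σ_{i<K}Λ^i e^{−(δ∕2)rL^i∕N}` whenever
  `N·|B(x) − B(y)| ≤ r + (N − 1)` (part O-a `mul_tdistT_blockOf_le`);
* §2 ★ **`fullProp_profile_decay_unif`** — `∃ C, δ > 0 ∀ K ≥ 1 ∀ N = L^K ∀ cube 2L^e ∀ 0 < m² ≤ m₀² ∀ x y,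
  |G(K, M, m²)(x, y)| ≤ C·(Σ_{i<K}Λ^i e^{−δ·r·L^i∕L^K})·e^{−δ·|B(x) − B(y)|_M}` — ALL pairs;
* §3 ★★ **`fullProp_powerLaw_decay_unif`** (`d ≥ 2`): `∀ x ≠ y, |G(K, M, m²)(x, y)| ≤ C·((L^K)∕r)^{d−1}·e^{−δ|B(x) − B(y)|_M}` — the printed SHAPE
  «`C|x − y|^{2−d}exp(−δ|x − y|)`» of Theorem 3.3 ∕ [Ba 4] for the FULL propagator in unit coordinates, uniformly in `K`, the volume and the
  mass; `fullProp_diag_decay_le_unif` (all pairs `≤ C·(L^K)^{d−1}·e^{−δ|B(x)−B(y)|}`);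
* §4 ★ **`fullProp_decay_two_blocks_unif`** (`d ≥ 2`): `∀ x y, 2 ≤ |B(x) − B(y)|_M → |G(K, M, m²)(x, y)| ≤ C·e^{−δ|B(x) − B(y)|_M}` — part O-a's
  statement with its threshold `D₀ = 1 + 2L^{d−1}∕(δ(L−1))` REPLACED BY `2` (two fine points whose unit blocks are `≥ 2` apart are `> L^K` apart,
  so the power-law factor is `≤ 1`).
WHAT THE CURVED CASE ADDS (one line): the same for `G_k(U)` uniformly over the live window `Reg335` (B9 (3.42)–(3.49) print operator bounds and
bounded unit-scale kernels; the sub-unit profile with decay is the [Ba 4]∕Theorem 3.3 shape, printed for the covariant propagator but not as an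
η-difference).
HONEST SCOPE.  (i) `A = 0`, periodic b.c., odd `L ≥ 3`, `0 < m² ≤ m₀²`, cubes `2L^e`; (ii) lattice units of level `K`; (iii) `K ≥ 1`; (iv) §3–§4 need
`d ≥ 2`; (v) the decay rate `δ` here is half of part R-a's (itself `min` of the base and slice rates) — immaterial for the shape; (vi) not Bałaban's
`G_k(U)`; not a discharge.
Locators: [King1986] C. King, CMP **102** (1986) 649–677: (2.13)–(2.17) p. 653, (2.20) p. 654, Theorem 3.3 p. 655, (3.7) p. 656, Prop. 3.7 (3.63)
p. 663; [Ba 4] = [Balaban1983RegularityDecay] Theorem (1.10) p. 573.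
-/

noncomputable section

namespace Summit.QuantumFields.YangMills.BalabanUVNodes.N15KingModelRung.Curved

open Real Finset Matrix
open Literature.MathematicalPhysics.QuantumFieldTheory.Balaban1983to89.B5Prop11Plancherel (Tor fine)
open Literature.MathematicalPhysics.QuantumFieldTheory.King1986 (aK aK_pos)
open Literature.MathematicalPhysics.QuantumFieldTheory.King1986.Torus (constrainedProp blockOf tdistT tdistT_nonneg)

variable {d : ℕ} (L : ℕ) [NeZero L]

/-! ## §1 Splitting the rate: every level decays at least on the unit scale -/

/-- One level: if `N·D ≤ r + (N − 1)` (`N ≥ 1`), `s ≥ 1`, `r ≥ 0`, `δ ≥ 0`, then `e^{−δ·r·s∕N} ≤ e^{δ∕2}·e^{−(δ∕2)D}·e^{−(δ∕2)·r·s∕N}` — half of the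
rate pays for the block decay (`r·s∕N ≥ r∕N ≥ D − 1`). [folklore] -/
theorem exp_level_split {δ r s N D : ℝ} (hδ : 0 ≤ δ) (hr : 0 ≤ r) (hs : 1 ≤ s) (hN : 1 ≤ N) (hD : N * D ≤ r + (N - 1)) :
    Real.exp (-(δ * (r * s / N))) ≤ Real.exp (δ / 2) * Real.exp (-(δ / 2 * D)) * Real.exp (-(δ / 2 * (r * s / N))) := by
  have hN0 : 0 < N := by linarith
  have h1 : r / N ≤ r * s / N := by
    rw [div_le_div_iff_of_pos_right hN0]
    exact le_mul_of_one_le_right hr hs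
  have h2 : D - 1 ≤ r / N := by
    rw [le_div_iff₀ hN0]
    linarith
  rw [← Real.exp_add, ← Real.exp_add]
  apply Real.exp_le_exp.mpr
  have h3 : δ / 2 * (D - 1) ≤ δ / 2 * (r * s / N) := mul_le_mul_of_nonneg_left (h2.trans h1) (by linarith)
  nlinarith

/-- **The level sum carries the block decay**: for `Λ ≥ 0`, `L ≥ 1`, `N ≥ 1`, `r ≥ 0`, `δ ≥ 0` and `N·D ≤ r + (N − 1)` (part O-a
`mul_tdistT_blockOf_le`: `D` = the unit-block distance, `r` = the fine distance):
`Σ_{i<K} Λ^i·e^{−δ·r·L^i∕N} ≤ e^{δ∕2}·e^{−(δ∕2)D}·Σ_{i<K} Λ^i·e^{−(δ∕2)·r·L^i∕N}`. [folklore] -/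
theorem levelSum_decay_split {Λ Lr δ r N D : ℝ} (hΛ : 0 ≤ Λ) (hL : 1 ≤ Lr) (hδ : 0 ≤ δ) (hr : 0 ≤ r) (hN : 1 ≤ N)
    (hD : N * D ≤ r + (N - 1)) (K : ℕ) :
    ∑ i ∈ Finset.range K, Λ ^ i * Real.exp (-(δ * (r * Lr ^ i / N)))
      ≤ Real.exp (δ / 2) * Real.exp (-(δ / 2 * D)) * ∑ i ∈ Finset.range K, Λ ^ i * Real.exp (-(δ / 2 * (r * Lr ^ i / N))) := by
  rw [Finset.mul_sum]
  refine Finset.sum_le_sum fun i _ => ?_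
  have hs : (1 : ℝ) ≤ Lr ^ i := one_le_pow₀ hL
  have h := exp_level_split hδ hr hs hN hD
  calc Λ ^ i * Real.exp (-(δ * (r * Lr ^ i / N)))
      ≤ Λ ^ i * (Real.exp (δ / 2) * Real.exp (-(δ / 2 * D)) * Real.exp (-(δ / 2 * (r * Lr ^ i / N)))) :=
        mul_le_mul_of_nonneg_left h (pow_nonneg hΛ i)
    _ = Real.exp (δ / 2) * Real.exp (-(δ / 2 * D)) * (Λ ^ i * Real.exp (-(δ / 2 * (r * Lr ^ i / N)))) := by ring

/-! ## §2 The profile with the block decay, all pairs -/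

/-- **THE UV PROFILE WITH THE UNIT-SCALE DECAY, ALL PAIRS**: for odd `L ≥ 3`, `a > 0`, `m₀² ≥ 0` there are `C, δ > 0` such that for EVERY `K ≥ 1`
(any spelling `N = L^K`), cube `M_μ = 2L^e`, mass `0 < m² ≤ m₀²` and ALL fine `x, y` (fine distance `r`, unit blocks `B(x), B(y)`):
`|G^η_K(x, y)| ≤ C·(Σ_{i<K} Λ^i·exp(−δ·r·L^i∕L^K))·exp(−δ·|B(x) − B(y)|_M)` — part R-a's level profile TIMES part O-a's block decay, with no
threshold (part R-a `fullProp_profile_unif` + §1 + part O-a `mul_tdistT_blockOf_le`).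
[cite: King1986, (2.13)–(2.17) p.653, (2.20) p.654, Theorem 3.3 p.655, (3.7) p.656, Prop. 3.7 (3.63) p.663; Balaban1983RegularityDecay, Theorem (1.10) p.573] -/
theorem fullProp_profile_decay_unif (hLodd : Odd L) (hL : 2 ≤ L) {a : ℝ} (ha : 0 < a) {m0sq : ℝ} (hm0 : 0 ≤ m0sq) :
    ∃ C δ : ℝ, 0 < C ∧ 0 < δ ∧ ∀ (K : ℕ), 1 ≤ K → ∀ (N : ℕ) [NeZero N], N = L ^ K →
      ∀ (e : ℕ) (M : Fin (d + 1) → ℕ) [∀ μ, NeZero (M μ)], (∀ μ, M μ = 2 * L ^ e) →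
      ∀ (msq : ℝ), 0 < msq → msq ≤ m0sq → ∀ x y : Tor (fine N M),
        |constrainedProp N M (aK a L K) (((N : ℕ) : ℝ) ^ 2) msq x y|
          ≤ C * (∑ i ∈ Finset.range K, ((L : ℝ) ^ (d + 1) / (L : ℝ) ^ 2) ^ i
              * Real.exp (-(δ * (tdistT (fine N M) x y * (L : ℝ) ^ i / (N : ℝ)))))
            * Real.exp (-(δ * tdistT M (blockOf N M x) (blockOf N M y))) := by
  have hLr : (1 : ℝ) ≤ L := by exact_mod_cast (show 1 ≤ L by omega)
  obtain ⟨C₀, δ₀, hC₀, hδ₀, H⟩ := fullProp_profile_unif (d := d) L hLodd hL ha hm0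
  refine ⟨C₀ * Real.exp (δ₀ / 2), δ₀ / 2, by positivity, by positivity, ?_⟩
  intro K hK N _ hN e M _ hM msq hmsq hcap x y
  have h := H K hK N hN e M hM msq hmsq hcap x y
  set Λ : ℝ := (L : ℝ) ^ (d + 1) / (L : ℝ) ^ 2 with hΛdef
  have hΛ : 0 ≤ Λ := by positivity
  set r : ℝ := tdistT (fine N M) x y with hrdef
  set D : ℝ := tdistT M (blockOf N M x) (blockOf N M y) with hDdef
  have hN1 : (1 : ℝ) ≤ (N : ℝ) := by
    rw [hN]
    exact_mod_cast Nat.one_le_pow K L (by omega)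
  have hD : (N : ℝ) * D ≤ r + ((N : ℝ) - 1) := mul_tdistT_blockOf_le N M x y
  have hsplit := levelSum_decay_split (K := K) hΛ hLr hδ₀.le (tdistT_nonneg _ x y) hN1 hD
  have hS0 : 0 ≤ ∑ i ∈ Finset.range K, Λ ^ i * Real.exp (-(δ₀ / 2 * (r * (L : ℝ) ^ i / (N : ℝ)))) :=
    Finset.sum_nonneg fun i _ => by positivity
  calc |constrainedProp N M (aK a L K) (((N : ℕ) : ℝ) ^ 2) msq x y|
      ≤ C₀ * ∑ i ∈ Finset.range K, Λ ^ i * Real.exp (-(δ₀ * (r * (L : ℝ) ^ i / (N : ℝ)))) := h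
    _ ≤ C₀ * (Real.exp (δ₀ / 2) * Real.exp (-(δ₀ / 2 * D))
          * ∑ i ∈ Finset.range K, Λ ^ i * Real.exp (-(δ₀ / 2 * (r * (L : ℝ) ^ i / (N : ℝ))))) :=
        mul_le_mul_of_nonneg_left hsplit hC₀.le
    _ = C₀ * Real.exp (δ₀ / 2) * (∑ i ∈ Finset.range K, Λ ^ i * Real.exp (-(δ₀ / 2 * (r * (L : ℝ) ^ i / (N : ℝ)))))
          * Real.exp (-(δ₀ / 2 * D)) := by ring

/-! ## §3 Power law × block decay (`d ≥ 2`) -/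

/-- **THE PRINTED SHAPE «`C|x − y|^{2−d}e^{−δ|x−y|}`» FOR THE FULL `A = 0` PROPAGATOR, ALL DISTINCT PAIRS** (`d ≥ 2`): for odd `L ≥ 3`, `a > 0`,
`m₀² ≥ 0` there are `C, δ > 0` such that for EVERY `K ≥ 1`, cube `2L^e`, mass `0 < m² ≤ m₀²` and all `x ≠ y`:
`|G^η_K(x, y)| ≤ C·((L^K)∕r)^{d−1}·exp(−δ·|B(x) − B(y)|_M)` — the power law of part R-b TIMES the block decay of part O-a, uniformly in `K`, the
volume and the mass, with no threshold (§2 + part R-b `levelSum_le_powerLaw` + part R-a `one_le_tdistT_of_ne`).  The (2.17)-summed SHAPE of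
Prop. 3.7 ∕ Theorem 3.3 for King's (2.13) at `A = 0`; nothing here is Bałaban's `G_k(U)`.
[cite: King1986, (2.13)–(2.17) p.653, Theorem 3.3 p.655, (3.7) p.656, Prop. 3.7 (3.63) p.663; Balaban1983RegularityDecay, Theorem (1.10) p.573] -/
theorem fullProp_powerLaw_decay_unif (hd : 2 ≤ d) (hLodd : Odd L) (hL : 2 ≤ L) {a : ℝ} (ha : 0 < a) {m0sq : ℝ} (hm0 : 0 ≤ m0sq) :
    ∃ C δ : ℝ, 0 < C ∧ 0 < δ ∧ ∀ (K : ℕ), 1 ≤ K → ∀ (N : ℕ) [NeZero N], N = L ^ K →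
      ∀ (e : ℕ) (M : Fin (d + 1) → ℕ) [∀ μ, NeZero (M μ)], (∀ μ, M μ = 2 * L ^ e) →
      ∀ (msq : ℝ), 0 < msq → msq ≤ m0sq → ∀ x y : Tor (fine N M), x ≠ y →
        |constrainedProp N M (aK a L K) (((N : ℕ) : ℝ) ^ 2) msq x y|
          ≤ C * (((L : ℝ) ^ K) / tdistT (fine N M) x y) ^ (d - 1)
            * Real.exp (-(δ * tdistT M (blockOf N M x) (blockOf N M y))) := by
  have hLr : (2 : ℝ) ≤ L := by exact_mod_cast hL
  have hL0 : (0 : ℝ) < L := by linarith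
  obtain ⟨C₀, δ, hC₀, hδ, H⟩ := fullProp_profile_decay_unif (d := d) L hLodd hL ha hm0
  have hp : 1 ≤ d - 1 := by omega
  set Kp : ℝ := (2 * ((d - 1) + 1).factorial / (δ / L) ^ ((d - 1) + 1) + 2) / (L : ℝ) ^ (d - 1) with hKp
  have hKp0 : 0 < Kp := by positivity
  refine ⟨C₀ * Kp, δ, mul_pos hC₀ hKp0, hδ, ?_⟩
  intro K hK N _ hN e M _ hM msq hmsq hcap x y hxy
  have h := H K hK N hN e M hM msq hmsq hcap x y
  set r : ℝ := tdistT (fine N M) x y with hrdef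
  set D : ℝ := tdistT M (blockOf N M x) (blockOf N M y) with hDdef
  have hr : 1 ≤ r := one_le_tdistT_of_ne (fine N M) hxy
  have hNc : (N : ℝ) = (L : ℝ) ^ K := by rw [hN]; push_cast; ring
  have hs : ∑ i ∈ Finset.range K, ((L : ℝ) ^ (d + 1) / (L : ℝ) ^ 2) ^ i * Real.exp (-(δ * (r * (L : ℝ) ^ i / (N : ℝ))))
      = ∑ i ∈ Finset.range K, ((L : ℝ) ^ (d - 1)) ^ i * Real.exp (-(δ * (r * (L : ℝ) ^ i / (L : ℝ) ^ K))) :=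
    Finset.sum_congr rfl fun i _ => by rw [Lam_eq_pow L hL (by omega), hNc]
  rw [hs] at h
  have hsum := levelSum_le_powerLaw hLr hδ hp K hr
  have hE : 0 ≤ Real.exp (-(δ * D)) := (Real.exp_pos _).le
  calc |constrainedProp N M (aK a L K) (((N : ℕ) : ℝ) ^ 2) msq x y|
      ≤ C₀ * (∑ i ∈ Finset.range K, ((L : ℝ) ^ (d - 1)) ^ i * Real.exp (-(δ * (r * (L : ℝ) ^ i / (L : ℝ) ^ K))))
          * Real.exp (-(δ * D)) := h
    _ ≤ C₀ * (Kp * (((L : ℝ) ^ K) / r) ^ (d - 1)) * Real.exp (-(δ * D)) :=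
        mul_le_mul_of_nonneg_right (mul_le_mul_of_nonneg_left hsum hC₀.le) hE
    _ = C₀ * Kp * (((L : ℝ) ^ K) / r) ^ (d - 1) * Real.exp (-(δ * D)) := by ring

/-- **THE DIAGONAL ORDER WITH THE BLOCK DECAY, ALL PAIRS** (`d ≥ 2`): `|G^η_K(x, y)| ≤ C·(L^K)^{d−1}·exp(−δ·|B(x) − B(y)|_M)` for all `x, y`
(§2 + part R-b `levelSum_le_geom`). [cite: King1986, Prop. 3.7 (3.63) p.663, (2.20) p.654] -/
theorem fullProp_diag_decay_le_unif (hd : 2 ≤ d) (hLodd : Odd L) (hL : 2 ≤ L) {a : ℝ} (ha : 0 < a) {m0sq : ℝ} (hm0 : 0 ≤ m0sq) :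
    ∃ C δ : ℝ, 0 < C ∧ 0 < δ ∧ ∀ (K : ℕ), 1 ≤ K → ∀ (N : ℕ) [NeZero N], N = L ^ K →
      ∀ (e : ℕ) (M : Fin (d + 1) → ℕ) [∀ μ, NeZero (M μ)], (∀ μ, M μ = 2 * L ^ e) →
      ∀ (msq : ℝ), 0 < msq → msq ≤ m0sq → ∀ x y : Tor (fine N M),
        |constrainedProp N M (aK a L K) (((N : ℕ) : ℝ) ^ 2) msq x y|
          ≤ C * ((L : ℝ) ^ K) ^ (d - 1) * Real.exp (-(δ * tdistT M (blockOf N M x) (blockOf N M y))) := by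
  have hLr : (2 : ℝ) ≤ L := by exact_mod_cast hL
  have hL0 : (0 : ℝ) < L := by linarith
  obtain ⟨C₀, δ, hC₀, hδ, H⟩ := fullProp_profile_decay_unif (d := d) L hLodd hL ha hm0
  refine ⟨C₀, δ, hC₀, hδ, ?_⟩
  intro K hK N _ hN e M _ hM msq hmsq hcap x y
  have h := H K hK N hN e M hM msq hmsq hcap x y
  rw [Lam_eq_pow L hL (by omega)] at h
  have hΛ2 : (2 : ℝ) ≤ (L : ℝ) ^ (d - 1) := by
    calc (2 : ℝ) ≤ L := hLr
      _ = (L : ℝ) ^ 1 := (pow_one _).symm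
      _ ≤ (L : ℝ) ^ (d - 1) := pow_le_pow_right₀ (by linarith) (by omega)
  have hgeom := levelSum_le_geom hΛ2 K (fun i => Real.exp (-(δ * (tdistT (fine N M) x y * (L : ℝ) ^ i / (N : ℝ)))))
    (fun i => Real.exp_le_one_iff.mpr (by
      have := tdistT_nonneg (fine N M) x y
      have : 0 ≤ δ * (tdistT (fine N M) x y * (L : ℝ) ^ i / (N : ℝ)) := by positivity
      linarith))
  have hE : 0 ≤ Real.exp (-(δ * tdistT M (blockOf N M x) (blockOf N M y))) := (Real.exp_pos _).le
  calc |constrainedProp N M (aK a L K) (((N : ℕ) : ℝ) ^ 2) msq x y|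
      ≤ C₀ * (∑ i ∈ Finset.range K, ((L : ℝ) ^ (d - 1)) ^ i
          * Real.exp (-(δ * (tdistT (fine N M) x y * (L : ℝ) ^ i / (N : ℝ)))))
          * Real.exp (-(δ * tdistT M (blockOf N M x) (blockOf N M y))) := h
    _ ≤ C₀ * ((L : ℝ) ^ (d - 1)) ^ K * Real.exp (-(δ * tdistT M (blockOf N M x) (blockOf N M y))) :=
        mul_le_mul_of_nonneg_right (mul_le_mul_of_nonneg_left hgeom hC₀.le) hE
    _ = C₀ * ((L : ℝ) ^ K) ^ (d - 1) * Real.exp (-(δ * tdistT M (blockOf N M x) (blockOf N M y))) := by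
        rw [← pow_mul, ← pow_mul, Nat.mul_comm]

/-! ## §4 Part O-a's off-diagonal decay with the threshold `2` -/

/-- **UNIFORM OFF-DIAGONAL DECAY WITH THRESHOLD `2`** (`d ≥ 2`): `∃ C, δ > 0 ∀ K ≥ 1 … ∀ x y, 2 ≤ |B(x) − B(y)|_M → |G^η_K(x, y)| ≤ C·e^{−δ|B(x) − B(y)|_M}`
— part O-a's `fullProp_decay_unif` with its threshold `D₀ = 1 + 2L^{d−1}∕(δ(L−1))` replaced by `2`: two fine points whose unit blocks are at
torus distance `≥ 2` are at fine distance `r ≥ L^K + 1` (part O-a `mul_tdistT_blockOf_le`), so the power-law factor of §3 is `≤ 1`.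
[cite: King1986, (2.13)–(2.17) p.653, Theorem 3.3 p.655, (3.7) p.656, Prop. 3.7 (3.64) p.663; Balaban1983RegularityDecay, Theorem (1.10) p.573] -/
theorem fullProp_decay_two_blocks_unif (hd : 2 ≤ d) (hLodd : Odd L) (hL : 2 ≤ L) {a : ℝ} (ha : 0 < a) {m0sq : ℝ} (hm0 : 0 ≤ m0sq) :
    ∃ C δ : ℝ, 0 < C ∧ 0 < δ ∧ ∀ (K : ℕ), 1 ≤ K → ∀ (N : ℕ) [NeZero N], N = L ^ K →
      ∀ (e : ℕ) (M : Fin (d + 1) → ℕ) [∀ μ, NeZero (M μ)], (∀ μ, M μ = 2 * L ^ e) →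
      ∀ (msq : ℝ), 0 < msq → msq ≤ m0sq →
      ∀ x y : Tor (fine N M), 2 ≤ tdistT M (blockOf N M x) (blockOf N M y) →
        |constrainedProp N M (aK a L K) (((N : ℕ) : ℝ) ^ 2) msq x y|
          ≤ C * Real.exp (-(δ * tdistT M (blockOf N M x) (blockOf N M y))) := by
  obtain ⟨C, δ, hC, hδ, H⟩ := fullProp_powerLaw_decay_unif (d := d) L hd hLodd hL ha hm0
  refine ⟨C, δ, hC, hδ, ?_⟩
  intro K hK N _ hN e M _ hM msq hmsq hcap x y hD
  set r : ℝ := tdistT (fine N M) x y with hrdef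
  set D : ℝ := tdistT M (blockOf N M x) (blockOf N M y) with hDdef
  have hN1 : (1 : ℝ) ≤ (N : ℝ) := by
    rw [hN]
    exact_mod_cast Nat.one_le_pow K L (by omega)
  have hND : (N : ℝ) * D ≤ r + ((N : ℝ) - 1) := mul_tdistT_blockOf_le N M x y
  -- `r ≥ N·D − (N − 1) ≥ 2N − N + 1 = N + 1`
  have hrN : (N : ℝ) + 1 ≤ r := by nlinarith
  have hNc : (N : ℝ) = (L : ℝ) ^ K := by rw [hN]; push_cast; ring
  have hr0 : 0 < r := by linarith
  have hxy : x ≠ y := by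
    intro hxy
    rw [hrdef, hxy, Literature.MathematicalPhysics.QuantumFieldTheory.King1986.Torus.tdistT_self] at hrN
    linarith
  have h := H K hK N hN e M hM msq hmsq hcap x y hxy
  have hratio : ((L : ℝ) ^ K) / r ≤ 1 := by
    rw [div_le_one hr0, ← hNc]
    linarith
  have hpow : (((L : ℝ) ^ K) / r) ^ (d - 1) ≤ 1 := pow_le_one₀ (by positivity) hratio
  have hE : 0 ≤ Real.exp (-(δ * D)) := (Real.exp_pos _).le
  calc |constrainedProp N M (aK a L K) (((N : ℕ) : ℝ) ^ 2) msq x y|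
      ≤ C * (((L : ℝ) ^ K) / r) ^ (d - 1) * Real.exp (-(δ * D)) := h
    _ ≤ C * 1 * Real.exp (-(δ * D)) :=
        mul_le_mul_of_nonneg_right (mul_le_mul_of_nonneg_left hpow hC.le) hE
    _ = C * Real.exp (-(δ * D)) := by rw [mul_one]

end Summit.QuantumFields.YangMills.BalabanUVNodes.N15KingModelRung.Curved
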